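import Mathlib
import HarnessLib
import HarnessLib.Audit
import Summits.Langlands.Statement
import Literature.NumberTheory.Automorphic.GaloisActionPlaces
import Literature.NumberTheory.Automorphic.LocalLanglandsDatumProofs
import HarnessLib.Audit.Status.Attr

/-!
Route: SmithKummerSeed

# Route SmithKummerSeed — residual reciprocity at the Kummer prime by Smith theory, then lifting
over the Kummer class, which already contains every CM field

It suffices to show X = T ∧ L ∧ S ∧ (the two ascent cruxes shared with route BaseFieldAscent),
realising card
Langlands/Langlands/smith-ai-mod-p (with the merged cards smith-radical-towers-over-q and
resolvent-kummer-smith-cubic), re-opened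
after route-Langlands-SmithKummer was retired `not-a-thesis` (its assembly stopped at T). The KUMMER
CLASS 𝒦 = fields F cyclic of prime
degree p over a totally real or CM field M containing a primitive p-th root of unity (F =
M(a^{1/p}): ℚ(ζ₃,∛m), ℚ(√(1+√2)), every
quadratic extension of a TR/CM field, hence EVERY CM field as F⁺(√−d) at p = 2).
T = ResidualGaloisRepKummer (crux 2, the card, NEW): mod-p Galois representations ρ̄_π : Γ_F →
GL_n(𝔽̄_p) with the predicted reduced
Frobenius polynomials for every regular algebraic cuspidal π of GL_n over F ∈ 𝒦 at the Kummer prime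
p = [F:M] — by Treumann–Venkatesh
Smith theory for the INNER order-p automorphism Ad(a^{1/p}) of GL_{pn}/M (fixed group
Res_{F/M}GL_n), Scholze's torsion theorem over
M and Clifford extraction; no weight, purity or CM-ness condition exists mod p, so the purity lock
that kills characteristic-0
induction from F is absent. Its foreseen children ResidualInductionKummer, CliffordExtractionModP
ride as support.
L = KummerPrimeLifting (crux 3): T ⇒ p-adic reciprocity (both directions, every finite place) at the
Kummer prime over every F ∈ 𝒦 —
positive-defect (Calegari–Geraghty) patching over F seeded by T, and residual automorphy over F by
SMITH DESCENT (the Tate-cohomology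
side of TV's "interior boundary" isomorphism H*_σ(X_G) ≅ H*_σ(X_G^σ), run from GL_{pn}/M down to
GL_n/F).
S = KummerPrimeToAllPrimes (crux 4): p-adic reciprocity at the Kummer prime ⇒ full reciprocity over
𝒦; for ℓ ≠ p this IS the
existence of Galois representations for the Kummer-monomial IRREGULAR cuspidal representations
AI_{F/M}(π) of GL_{pn} over CM fields
(honestly flagged: contains that slice of the non-regular core; n = 1 is class field theory).
Since 𝒦 ⊇ CM fields, reciprocity over 𝒦 gives CM, then TR (shared support ReciprocityCMtoTR,
Sorensen patching), then
conjugation-solvable and all number fields by BaseFieldAscent's shared cruxes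
AscentConjugationSolvable, AscentResidual.
Honest position: given reciprocity over TR∪CM in ALL weights, 𝒦 is cyclic-layer bookkeeping
(BaseFieldAscent #3); this route is the
F-internal alternative that does not wait for the irregular core at the Kummer prime, and the only
line producing Galois
representations for TORSION classes over fields that are neither TR nor CM.
Lean: `ResidualGaloisRepKummer ∧ KummerPrimeLifting ∧ KummerPrimeToAllPrimes ∧ ReciprocityCMtoTR ∧
AscentConjugationSolvable ∧ AscentResidual ∧ DatumIndependence`

## Assembly
Pure logic plus one Mathlib fact, certified natively (`closes`, axioms propext/choice/Quot.sound):
L∘T gives p-adic reciprocity at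
the Kummer prime over 𝒦, S upgrades it to full reciprocity over 𝒦; every CM field F is the degree-2
Kummer extension of its maximal
real subfield (Mathlib `NumberField.IsCMField`: `IsQuadraticExtension F⁺ F`, ζ₂ = −1 by
`IsPrimitiveRoot.neg_one`), so reciprocity
holds over all CM fields; ReciprocityCMtoTR gives all totally real fields; TR ∨ CM feeds
AscentConjugationSolvable, and AscentResidual
gives, over EVERY number field, reciprocity data R₀ WITH the correspondence (the chain's
pre-revision currency `∃ R, ∀ n>0 hcpt, GLC`).
Statement revision p141787 (2026-08-17, `Langlands := ∀ F, Nonempty (ReciprocityData F) ∧ ∀ Rec n,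
…`, data pinned to the canonical
Artin maps): R₀ is the non-vacuity witness, `IsGeometricFramed` is datum-free (`ReciprocityData.pst`
pinned), and the support
DatumIndependence (Henniart rigidity on generic classes, read through `Corresponds`; local
components of cuspidal π are generic)
transports (A) and (B) from R₀ to every datum — route-repair rev 6.

Rationale: WHY THIS LINE. Every construction of ρ_π realises π in a Shimura variety
(ShimuraVarietyRealizationBarrier), impossible over F ∈ 𝒦 ∖ (TR∪CM), and
characteristic-0 induction to M lands in irregular weight by strong purity (arXiv:2207.03393 Prop.
2.6, Clozel1990 Lem. 4.9); mod p both
obstructions dissolve: TreumannVenkatesh2016 (First Main Theorem, §4.3, §5.5; arXiv:1407.2346)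
transports ANY mod-p eigenclass of
H = G^σ to G along the normalised Brauer homomorphism, and Scholze2015 Thm V.4.1 gives Galois
determinants for every mod-p eigenclass of
GL_N over TR/CM fields. The card's move is to take σ INNER, σ = Ad(a^{1/p}) on GL_{pn}/M, so that H
= Res_{F/M}GL_n lives over the
non-CM field F while G lives over the CM field M, the Kummer hypothesis μ_p ⊂ M making every q_v ≡ 1
(mod p) and killing the √q-twists
of TV §7.8 (the one-line lemma KummerResidueCharOne, q_v ≡ 1 mod p — dropped from the item list at
rev 6 under the 15-item cap, to be attached by provers with --supports); Feng's local functoriality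
(arXiv:2312.12542 Ex. 9.1.3) covers the inner σ locally.
Imported areas: ℤ/p-equivariant algebraic topology (P. A. Smith theory, Tate cohomology,
Quillen–Borel localisation) and modular
representation theory (Brauer homomorphism), with TV's explicit dictionary eigenclass ↦ eigenclass,
Satake parameter moved by the σ-dual
map = automorphic induction here. What this route adds to the retired SmithKummer: the deciding
chain to `Langlands` (𝒦 ⊇ CM at
p = 2, so no separate TR/CM crux is needed and T stays load-bearing in `closes`), the lifting crux L
with the Smith-DESCENT proposal for
residual automorphy over non-CM F (TV §1.3: Y ↪ X is almost an isomorphism on σ-equivariant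
cohomology, so a σ-stable eigensystem of
GL_{pn}/M whose localised complex is not k[σ]-perfect descends to GL_n/F), and the identification of
the ℓ ≠ p residue S with the
Kummer-monomial slice of the non-regular core (CalegariGeraghty2017, KhareThorne2017,
ACCGHLNSTT2023, BarnetlambEtAl2014 §5).

RANKED CRUXES. #2 ResidualGaloisRepKummer (crux) — T (card X_p for reductions of characteristic-0
classes): for p prime, M totally real or CM with a primitive p-th root of unity, F/M Galois of
degree p, every regular algebraic cuspidal π of GL_n(𝔸_F), every ι : ℚ̄_p ≃ ℂ and every reduction
red of ℤ̄_p into an algebraically closed discrete field k of characteristic p, there is ρ̄ : Γ_F →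
GL_n(k) such that for all but finitely many places w: if π has Satake parameter α at w then the
lang.S27 Frobenius polynomial arithFrobPolyOfSatake ι q_w n α has an integral model P₀ and ρ̄ is
unramified at w with charpoly(ρ̄(Frob_w)) = red(P₀). Same signature as the retired route's target
stmt-Langlands-2674 (now THE crux). Non-vacuous: M = ℚ(ζ₃), F = M(∛2), n = 1 (class field theory); p
= 2, M = ℚ(√2), F = ℚ(√(1+√2)). The all-torsion form waits for the definition
modPHeckeEigensystemGL. [difficulty: XL] (why it might fail: TV's First Main Theorem needs only G^σ
connected, but the σ-dual identification is printed for G simply connected, H semisimple; H = Res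
GL_n is not (PGL₂/inner-order-3 caveat, SL→GL scalar ambiguity μ_{n'}); Brauer–Satake must be
induction at INERT places; ¬T would refute (A) at ℓ = p over F.) [TreumannVenkatesh2016,
Scholze2015, arXiv:1407.2346, arXiv:2312.12542, Feng2024, Ash2003]
#3 KummerPrimeLifting (crux) — L: T ⇒ for every (p, M, F) as in T there are reciprocity data 𝓡 for F
such that for all n ≥ 1 and hcpt: (A) at ℓ = p — every L-algebraic cuspidal π of GL_n(𝔸_F) has, for
every ι : ℚ̄_p ≃ ℂ, an irreducible geometric ρ_{π,ι} : Γ_F → GL_n(ℚ̄_p) corresponding to π at every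
finite place, unique up to conjugacy — and (B) at ℓ = p — every irreducible geometric p-adic ρ of
Γ_F corresponds to an L-algebraic cuspidal π. Foreseen mechanism: (A)_p for regular π by
Calegari–Geraghty positive-defect patching over F (l₀ = r₂(n−1) > 0) with T and its torsion/family
upgrade (CG Conjecture B over F) as Galois input; (B)_p by residual automorphy over F via SMITH
DESCENT — TV's equivariant isomorphism H*_σ(X_{GL_{pn}/M}) ≅ H*_σ(X^σ), X^σ ⊇ X_{Res_{F/M}GL_n}: the
eigensystem of Ind_F^M ρ̄, if Serre-modular over the CM field M and with non-k[σ]-perfect localised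
complex (e.g. Euler characteristic ≢ 0 mod p), occurs for GL_n/F — then R = 𝕋 over F; irregular
L-algebraic π over F have no cohomological avatar and are the open residue. [deps:
ResidualGaloisRepKummer] [difficulty: open-problem] (why it might fail: l₀ = r₂(n−1) > 0: CG
patching over F needs torsion Galois DETERMINANTS with local–global compatibility (CG Conj. B), far
beyond T's 𝔽̄_p layer, and Smith theory has no ℤ/p² version; (B)_p needs Serre-modularity over M
plus a non-perfectness criterion nobody has; irregular π over F untouched.) [CalegariGeraghty2017,
KhareThorne2017, ACCGHLNSTT2023, TreumannVenkatesh2016, CalegariVenkatesh2019, Scholze2015]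
#4 KummerPrimeToAllPrimes (crux) — S: p-adic reciprocity at the Kummer prime over every F ∈ 𝒦 (the
conclusion of L) ⇒ full reciprocity over every F ∈ 𝒦: ∃ 𝓡, ∀ n ≥ 1, ∀ hcpt,
GlobalLanglandsCorrespondenceGLn n F 𝓡 hcpt. Content for ℓ ≠ [F:M]: ℓ-adic Galois representations
(and the converse direction) for the Kummer-MONOMIAL irregular cuspidal representations Π =
AI_{F/M}(π) of GL_{pn}(𝔸_M) (Π ≅ Π ⊗ η_{F/M}; by strong purity the weights of π descend from M, so
Π_∞ repeats each Hodge–Tate weight p times), followed by restriction to Γ_F and Clifford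
de-induction over twists; n = 1 is class field theory + Weil (algebraic Hecke characters of F factor
through M up to finite order). For F CM (p = 2) it contains reciprocity over CM fields in all
weights. [deps: KummerPrimeLifting] [difficulty: open-problem] (why it might fail: For ℓ ≠ [F:M] the
only bridge to CM fields is induction to M, irregular by strong purity (arXiv:2207.03393 Prop. 2.6);
potential automorphy cannot leave TR∪CM (subfields of CM fields are TR/CM), so no compatible system
over F is constructible: as a reduction it may be exactly the non-regular core.) [arXiv:2207.03393,
Clozel1990, BarnetlambEtAl2014, ArthurClozelAMS120, HarrisLanTaylorThorneRMS2016, Taylor1994]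
#5 AscentConjugationSolvable (crux) — SHARED with route BaseFieldAscent (stmt-Langlands-1094,
verbatim): reciprocity over TR∪CM ⇒ reciprocity over every CONJUGATION-SOLVABLE F (∃ totally real F₀
and a finite Galois E ⊇ F ⊇ F₀ with IsSolvable (E ≃ₐ[F₀] E)). Up-steps along cyclic prime layers by
Arthur–Clozel AI/BC + Clifford theory + de-induction over twists, down-steps by cyclic descent. Here
it is fed by 𝒦 ⊇ CM and ReciprocityCMtoTR; every subfield of a 𝒦-field is conjugation-solvable (its
conjugation-closure group is (elementary abelian p).2). [deps: KummerPrimeToAllPrimes] [difficulty: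
L] (why it might fail: Non-normal layers (pure cubics…) need non-normal solvable BC/descent: the
twist/extension ambiguity at non-split places is not resolvable without reciprocity over an
intermediate non-TR/CM field (circular). Known for cubic GL_2 only (JPSS; image/fibres subtle:
Lapid–Rogawski, Rajan); AC p.191.) [ArthurClozelAMS120, doi:10.4310/mrl.2002.v9.n4.a9,
doi:10.1515/form.10.2.175, Taylor1994, BoxerEtAl2021]
#6 AscentResidual (crux) — SHARED with route BaseFieldAscent (stmt-Langlands-1095, verbatim):
reciprocity over all conjugation-solvable fields ⇒ reciprocity over ALL number fields; the residual
class ([F:F^tr] ≥ 5 with insoluble conjugation-closure) is one functoriality away: BC/AI/descent for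
GL_n along Galois extensions with simple non-abelian group. Smith theory does not touch it (order-p
symmetries give cyclic layers only). [deps: AscentConjugationSolvable] [difficulty: open-problem]
(why it might fail: Needs GL_n BC/AI/descent along simple non-abelian Galois layers: no
trace-formula comparison exists (GetzHahn2024 §13.4 'unavailable'; Getz2012 conditional, SL₂(𝔽₅)
only); Galois-theoretic insoluble BC needs a TR/CM top field, excluded here; may be no easier than
the summit.) [Getz2012Nonsolvable, GetzHahn2024, Calegari2023, ArthurClozelAMS120]
#9 ReciprocityCMtoTR (support) — SHARED with routes BaseFieldAscent/CMFern (stmt-Langlands-1096,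
verbatim): reciprocity over all CM fields ⇒ over all totally real fields: (A) by Sorensen patching
over an S-general family of imaginary-quadratic composita FK_i (tree:
PatchingLemma/SorensenPatching), LGC and de Rhamness transferred from a K_i splitting v; (B) by
quadratic descent of automorphy given (A) over F (Arthur–Clozel). Theorem-level. [difficulty: L]
[Sorensen2020, ArthurClozelAMS120, BarnetlambEtAl2014]
#9 ResidualInductionKummer (support) — foreseen child X1 of T (retired route's stmt-Langlands-2676,
verbatim): in the setting of T the Frobenius polynomials of π at w ∤ p have integral models P₀(w),
and for every mod-p character χ of Γ_F with Frobenius values c there is R_χ : Γ_M → GL_{pn}(k) with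
charpoly((R_χ|Γ_F)(Frob_w)) = ∏_{g ∈ Gal(F/M)} red(P₀(g·w)).scaleRoots(c(g·w)) for almost all w —
the Galois shadow of Smith-theoretic automorphic induction of (π mod p) ⊗ χ: TV First Main Theorem
for (GL_{pn}/M, Ad a^{1/p}) (or SL_{pn} + central bookkeeping) on the trivial-weight deeper-level
avatar of π ⊗ χ̃, Brauer–Satake = induction (all √q-twists trivial since q_v ≡ 1 mod p), Scholze2015
V.4.1 (m = 1) over M as a named-fact hypothesis, Ind/restriction dictionary
`hasFrobCharpolyAt_outerConj_iff`. [deps: CliffordExtractionModP] [difficulty: XL] [difficulty: XL]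
[TreumannVenkatesh2016, Scholze2015, Ash2003, Feng2024, arXiv:2312.12542]
#9 CliffordExtractionModP (support) — foreseen child X2 of T (retired route's stmt-Langlands-2675,
verbatim; pure Galois theory, prover-ready): F/M Galois of prime degree p = char k, k algebraically
closed discrete, P : places of F → k[X] monic of degree n a.e.; IF for every continuous character χ
: Γ_F → k^× (Frobenius values c a.e.) there is R_χ : Γ_M → GL_{pn}(k) whose restriction to Γ_F has
charpoly(Frob_w) = ∏_{g ∈ Gal(F/M)} P(g·w).scaleRoots(c(g·w)) a.e., THEN there is τ : Γ_F → GL_n(k)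
with charpoly τ(Frob_w) = P(w) a.e. Tools in tree: AbsGaloisOuterConj, RestrictFieldSemisimple,
FrobeniusDensityTheorem, LAdicRepFrobenius (Brauer–Nesbitt). Hand-checked n = 1, p = 2. X1 → X2 → T
is bookkeeping in tree (the retired route's assembly). [difficulty: L] [difficulty: L]
[SerreLinearRepresentations1977, ChenevierHarris2013, Sorensen2020, TreumannVenkatesh2016]
#9 DatumIndependence (support, route-repair rev 6, stmt-Langlands-18101) — for every number field F,
any two pinned reciprocity data Rec, Rec′, n ≥ 1, hcpt, cuspidal π, ℓ, ι, ρ: Corresponds Rec ι π ρ →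
Corresponds Rec′ ι π ρ (datum independence of the summit's correspondence predicate = Henniart
rigidity of the local Langlands correspondence on GENERIC classes, read through `Corresponds`; local
components of cuspidal π are generic). It is the exact price of the statement revision p141787 (∃𝓡 ↦
Nonempty ∧ ∀𝓡, data pinned to the canonical Artin maps) for this route's ∃-shaped reciprocity items
and the last hypothesis of `closes`; verbatim the DatumIndependence of crux stmt-Langlands-17925's
line (Cruxes/ReciprocityUpToIrreducibilityR/SketchIdeateR1K2.lean, reduced there sorry-free to
LocalGenericRigidity); untouched by Negative/ReciprocityDataNotRigid (swapDatum moves non-generic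
GL₂ classes only). [difficulty: L] (why it might fail: the tree's IsLocalLanglandsGL pins rec_n by
L/ε of generic pairs and by named-fact uniqueness on supercuspidals only; a lawful pinned datum
permuting generic non-supercuspidal classes would refute it — and the revised summit's ∀𝓡 with it.)
[Henniart1993, Henniart2002, HarrisTaylorAMS2001, DeligneAntwerpII1973, Shalika1974]
#9 AscentConjugationSolvableOfCyclicPrime (support, stmt-Langlands-17881; = 19073 restated 1:1 at
rev 6 to detach a cyclic by-name closure) — CyclicPrimeAscent → CyclicPrimeDescent →
AscentConjugationSolvable, the glue of the crux-strategist split of #5; PROVED in tree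
(Theorems/SmithKummerSeedAscentConjugationSolvableSplit.lean,
`ascentConjugationSolvable_of_pieces`), to be re-closed only by a cycle-free (structural) module or
consumed by the tenure seat's formal --split … --glue-by. [difficulty: provable-now]
[ArthurClozelAMS120]

TWO-LAYER PLAN. T ⇐ ResidualInductionKummer → CliffordExtractionModP → T (the retired route's
assembly; glue = bookkeeping in tree:
`eventually_cofinite_isUnramifiedAt_holds`, `HasSatakeParamAt.card_eq`,
`natDegree_arithFrobPolyOfSatake`, `hasSatakeParamAt_unique`),
to be filed as the formal split of T once either child moves; inside X1, once the definitions land: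
X1 ⇐ BrauerSatakeIsInduction →
SmithTransferGL → (Scholze V.4.1 as hypothesis + Ash–Stevens trivial weight + integrality) → X1. L ⇐
(A)_p-regular (CG patching seeded
by T) → (B)_p (Smith descent + R = 𝕋) → L, only after T closes. S ⇐ (n = 1: CFT + Weil, provable) →
(restriction/Clifford bookkeeping
given Galois representations for Kummer-monomial Π over M) → S. Nothing filed now.

KILL CRITERIA. (i) Brauer–Satake for (GL_{pn}(M_v), Ad a^{1/p}) computed at one split and one inert
place and found NOT to be induction even after
TV's global Aut(k/𝔽_p)-untwist and a central character: T's mechanism is dead — close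
`refuted:ResidualGaloisRepKummer` only if T itself
is refuted (T is implied by the summit at ℓ = p plus integrality, so ¬T would also be a negative of
the SUMMIT over F, to be recorded
as such); otherwise pivot X1 to TV's c-group variant (§7.8) by a new support item. (ii) Refuter
numerics: p = 3, M = ℚ(ζ₃), F = M(∛2),
n = 1: a mod-3 ray-class character of F whose induced eigensystem is absent from H*(Γ ≤ GL₃(ℤ[ζ₃]),
𝔽₃) at the predicted level
refutes X1. (iii) A counterexample datum to CliffordExtractionModP forces a restatement of X2 with
the extra structure the transfer
really provides (multiplicativity in χ, determinant), not a close. (iv) L, S, and the shared ascent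
cruxes are implied by the summit
and cannot be refuted alone; the route goes DORMANT if a census on L shows positive-defect patching
over F cannot consume residual-only
input in any form (then T is a terminal torsion statement: keep T/X1/X2 as support of
BaseFieldAscent and close `superseded` by it).
(v) BaseFieldAscent.AscentConjugationSolvable PROVED for cyclic prime layers makes S bookkeeping
given the CM core; Galois
representations for torsion classes over arbitrary number fields proved elsewhere moot T
(supersede). (vi) DatumIndependence (support, in `closes`) is implied by the revised summit: a
refutation AS TYPED (a lawful pinned reciprocity datum whose rec_v differs on a GENERIC class)
refutes `Langlands`'s ∀𝓡 itself and is a STATEMENT-level finding (audit:statement), not a death of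
this line — the chain's ∃-currency conclusions survive it.

NOT DECOMPOSED YET. The internal glue of X1 (TV transfer instance for reductive non-semisimple H,
Scholze as named fact, Franke + Ash–Stevens
weight-to-level, p-integrality, σ-plain levels at places dividing a·disc(F/M));
small-image/repeated-root cases of X2; everything at
ramified places and v ∣ p inside T (TV §6 linkage); the non-normal sharpening of T (merged card
smith-radical-towers-over-q:
Ad(a^{1/p}) is rational over any field containing a, so M(a^{1/p}) non-Galois and p-radical towers
with the same prime are in range,
at the cost of TV's √q-twists) and the two-quadratic-steps descent to complex cubic fields (merged
card resolvent-kummer-smith-cubic;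
Sorensen patching in tree) — both expansions of T filed only after T moves; the split of L into
(A)_p / (B)_p / irregular-over-F and
the Smith-descent non-perfectness criterion; the split of S (n = 1 provable slice; Kummer-monomial
irregular Π over M); nothing
below the shared BaseFieldAscent cruxes (that route owns their decomposition).

CHEAPEST FALSIFIER. The inert-place Brauer–Satake computation for n = 1, p = 3: G = GL₃(M_v), σ =
Ad(a^{1/3}) with F_w/M_v the unramified cubic
extension (q_v ≡ 1 mod 3), H_v = F_w^× ⊂ GL₃(M_v) an elliptic torus; TV eq. (4.3) NBr(h)(U, gU) =
((h*h*h)(K, gK))^{1/3}: is the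
transferred unramified character β ↦ the parameter with cube β (unique cube root in characteristic
3), i.e. induction? The split
place was hand-checked by the g1 planner (s ↦ s^p, undone by the global Aut(k/𝔽_p)-untwist of TV
§4.3); the inert place is a
one-page computation a refuter should do first, then compare with Ash2003 (torus case over ℚ) for
normalisations. Not machine-run
this session (no kit in plancard mode).

NUMBERS. [F:M] = p = char k = ord(σ); q_v ≡ 1 (mod p) for all v ∤ p (Kummer); l₀(Res_{F/ℚ}GL_n) =
r₂(n−1) for F totally complex, r₁(n−1)/2 + r₂(n−1)
resp. r₁(n−2)/2 + r₂(n−1) (n odd/even) in general (KhareThorne2017 eq. (6.2)), > 0 for every F ∈ 𝒦 ∖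
TR and n ≥ 2 (TaylorWilesNumericalCoincidence); strong purity: AI_{F/M}(π)_∞
repeats each Hodge–Tate weight exactly p times (arXiv:2207.03393 Prop. 2.6); Scholze V.4.1:
nilpotent ideal exponent N([M:ℚ], pn),
irrelevant for eigen-characters; items at open: 10 (5 cruxes of which 2 shared, 4 support, 1
assembly). Items at rev 7: 15 = 7 cruxes (T, L, S, AscentConjugationSolvable + its split pieces
CyclicPrimeAscent / CyclicPrimeDescent, AscentResidual; 4 shared or strategist-filed), 7 support
(ReciprocityCMtoTR, ResidualInductionKummer, CliffordExtractionModP,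
AscentConjugationSolvableOfCyclicPrime, DatumIndependence, and the informal BrauerSatakeIsInduction
/ SmithTransferGL), 1 assembly; `closes` binds T, L, S, ReciprocityCMtoTR,
AscentConjugationSolvable, AscentResidual, DatumIndependence.

DEFINITION REQUESTS. (D1) `modPHeckeEigensystemGL` (topic Literature/NumberTheory/Automorphic):
singular cohomology H^i(X_K, k) of the locally symmetric
space of GL_N over a number field with its prime-to-S Hecke action (tree:
`Literature.NumberTheory.Automorphic.heckeAlgebra`) and
`OccursIn θ` for a k-character θ — needed to state TreumannVenkatesh2016 §5.5 and Scholze2015 V.4.1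
as named facts, to type the
informal cruxes BrauerSatakeIsInduction / SmithTransferGL of the retired route, the all-torsion form
of T, and the Smith-descent
statement inside L. (D2) `normalizedBrauerHom` and (D3) `satakeTransformModP` as in the retired
route's requests (TV §4.1–4.3;
integral Satake for GL_N with q ∈ R^×). Cite facts wanted: TreumannVenkatesh2016 §5.5 Theorem;
Scholze2015 Thm V.4.1 (m = 1);
Ash2003 main theorem.

Novelty: Searches (2026-08-15, this session): `lit search --source zbmath` "Smith theory cyclic base change
functoriality" (1: Feng2024 =
arXiv:2009.14236), "Brauer homomorphism Hecke algebra" (8; only TreumannVenkatesh2016 relevant),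
"Tate cohomology Hecke Smith theory"
(0), "automorphic induction Galois representations non-regular" (0 relevant), "Serre conjecture
number field not totally real mod p
Galois representations automorphic" (8: BDJ, Gee–Savitt… all TR), "torsion cohomology Galois
representations arithmetic groups non CM
field" (4: ACC+, Harris 1999, Pilloni–Stroh, Tilouine–Urban — all TR/CM), "modularity lifting … not
totally real imaginary GL(n)
Calegari Geraghty torsion" (0); `lit search --source arxiv` "Smith theory Hecke algebra Brauer
homomorphism mod p functoriality" (0);
`lit galaxy search --star all` "Smith theory Brauer homomorphism Galois representations torsion" /
"Tate cohomology automorphic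
induction mod p" / "modularity lifting theorems over number fields that are not CM" / "torsion
Galois representations" (0 each),
"Smith theory and" / "Brauer homomorphism" (panama: unrelated classics only); local searchd (hybrid)
unavailable (rc 75);
`lit frontier Langlands --since 2023` (no Smith/Brauer/Tate rows); `ledger negatives --problem
Langlands` (1 entry, K3 Kuga–Satake,
unrelated); TV arXiv:1407.2346 re-read pp. 3–4 (First/Second Main Theorems, §1.3 "interior boundary"
equivariant isomorphism,
PGL₂ inner caveat); plus the card's seven refuter audit passes (arXiv:1  [refs: 2009.14236, 1407.2346, 2312.12542, 2207.03393, Feng2024, TreumannVenkatesh2016, Ash2003, CalegariGeraghty2017, KhareThorne2017]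

Barriers (technique_class: smith-theory torsion-functoriality automorphic-induction): - technique_class: smith-theory torsion-functoriality automorphic-induction
- Literature.Barriers.Langlands.ShimuraVarietyRealizationBarrier: sidestepped for T — π over F is
never realised in a variety; its mod-p eigenclass is moved TOPOLOGICALLY (ℤ/p-localisation at the
fixed locus of Ad(a^{1/p})) to GL_{pn}/M where Scholze's boundary construction lives; the barrier's
proved content (`ShimuraVarietyRealizationBarrier_holds`) is untouched. It bites again on S for ℓ ≠
p (not evaded; named as the crux).
- Literature.Barriers.Langlands.NonRegularWeightBarrier: evaded mod p only (torsion eigenclasses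
carry no weight; Scholze V.4.1 reduces every weight to trivial weight at deeper level); in
characteristic 0 AI(π) is irregular by strong purity, which is exactly crux S — not evaded there;
the bet is that the Kummer-monomial slice (Π ≅ Π ⊗ η, weights repeated exactly p times, p-adic
member known by L) is the most structured entry point into the non-regular core.
- Literature.Barriers.Langlands.TaylorWilesNumericalCoincidence: bites on L (l₀ = r₂(n−1) > 0 over
every F ∈ 𝒦 ∖ TR); evasion = Calegari–Geraghty positive-defect patching, which consumes precisely
the torsion Galois input T begins to supply; not evaded beyond that — named in L's why-might-fail.
- Literature.Barriers.Langlands.TaylorWilesNumericalCoincidenceNarrow: same as above (the narrow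
form is the l₀ > 0 deficit itself).
- Literature.Barriers.Langlands.PatchingLocalComponentBarrier: bites on L at v ∣ p and ramified v
(loc

Novelty grade: new-combination — ROUTE REVIEW 2 (refuter-rreview1-…-f1ba07c2-0, 2026-08-16; extends REVIEW 1 by rreview-0815T18-21-0 = REVIEW.md on stmt-12176; full text REVIEW2.md on 12176): ADMISSIBLE, KEEP OPEN; not a recombination of closed routes (SmithKummer retired for form; BaseFieldAscent/CMFern open). Grade unchanged new- (refuter refuter-rreview1-Langlands-SmithKummerSeed-f1ba07c2-0, 2026-08-16T19:19:06Z; prior: TreumannVenkatesh2016 (arXiv:1407.2346), Scholze2015, Feng2024 (arXiv:2009.14236), arXiv:2312.12542, CalegariGeraghty2017, KhareThorne2017, route-Langlands-BaseFieldAscent (stmt-Langlands-1093..1098), route-Langlands-SmithKummer (retired, same card))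

History (route lifecycle, newest last):
- 2026-08-17T08:22:24Z · rev 6: restated AscentConjugationSolvableOfCyclicPrime (stmt-Langlands-19073 proved) — @note_rev6.txt (planner-rglue-Langlands-SmithKummerSeed-f1ba07c2-0)
- 2026-08-17T08:22:24Z · rev 6: dropped KummerResidueCharOne — @note_rev6.txt (planner-rglue-Langlands-SmithKummerSeed-f1ba07c2-0)
- 2026-08-17T08:28:55Z · rev 7: restated Assembly (stmt-Langlands-12176) — route-repair glue-native-fail, rev 7 (hygiene) — also RECORDS rev 6, whose --note went in as a literal file name. REV 6: root cause = statement revision p141787 (planner-rglue-Langlands-SmithKummerSeed-f1ba07c2-0)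
- 2026-08-26T00:36:50Z · DORMANT — reconciler: no traction for 8.2 d (last activity statement-grounded at 2026-08-17T19:19:49Z); parked, not closed — `ledger route dormant route-Langlands-SmithKu (operator:999:3098336)
- 2026-08-29T03:32:41Z · REACTIVATED — reconciler: reactivated — activity statement-checked at 2026-08-29T01:50:43Z after parking at 2026-08-26T00:36:50Z (operator:999:526989)

sub-problem: Langlands · status: open · opened planner-plancard-Langlands-Langlands-smith-ai-3012b3a8-g2-0 2026-08-15T18:50:31Z · rev 11 · ledger route-Langlands-SmithKummerSeed
GENERATED by the gate from the ledger (D-0016/17). Provers cite these decls: `theorem foo : Summit.Langlands.Langlands.Theses.SmithKummerSeed.<Decl> := …` in Summits/Langlands/Langlands/Theorems/<Name>.lean.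
-/

namespace Summit.Langlands.Langlands.Theses.SmithKummerSeed

open scoped BigOperators Topology Manifold Classical MeasureTheory ProbabilityTheory Matrix InnerProductSpace ComplexConjugate ContinuousMap
open Filter Set Function TopologicalSpace MeasureTheory

attribute [summit_statement] _root_.Langlands

/-- item stmt-Langlands-12170 · crux · rank 2 · open · by planner
why it might fail: TV's First Main Theorem needs only G^σ connected, but the σ-dual identification is printed for G simply connected, H semisimple; H = Res GL_n is not (PGL₂/inner-order-3 caveat, SL→GL scalar ambiguity μ_{n'}); Brauer–Satake must be induction at INERT places; ¬T would refute (A) at ℓ = p over F.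
sources: TreumannVenkatesh2016, arXiv:1407.2346, Scholze2015, arXiv:2312.12542, Feng2024, Ash2003
[crux] T (card X_p for reductions of characteristic-0 classes): for p prime, M totally real or CM
with a primitive p-th root of unity, F/M Galois of degree p, every regular algebraic cuspidal π of
GL_n(𝔸_F), every ι : ℚ̄_p ≃ ℂ and every reduction red of ℤ̄_p into an algebraically closed discrete
field k of characteristic p, there is ρ̄ : Γ_F → GL_n(k) such that for all but finitely many places
w: if π has Satake parameter α at w then the lang.S27 Frobenius polynomial arithFrobPolyOfSatake ι
q_w n α has an integral model P₀ and ρ̄ is unramified at w with charpoly(ρ̄(Frob_w)) = red(P₀). Same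
signature as the retired route's target stmt-Langlands-2674 (now THE crux). Non-vacuous: M = ℚ(ζ₃),
F = M(∛2), n = 1 (class field theory); p = 2, M = ℚ(√2), F = ℚ(√(1+√2)). The all-torsion form waits
for the definition modPHeckeEigensystemGL. [difficulty: XL] -/
@[route_item "route-Langlands-SmithKummerSeed", crux]
def ResidualGaloisRepKummer : Prop :=
  ∀ (p : ℕ) [Fact p.Prime] (M F : Type) [Field M] [NumberField M] [Field F] [NumberField F] [Algebra M F] [IsGalois M F], (NumberField.IsTotallyReal M ∨ NumberField.IsCMField M) → (∃ ζ : M, IsPrimitiveRoot ζ p) → Module.finrank M F = p → ∀ (n : ℕ) (hcpt : Literature.NumberTheory.Automorphic.isCompact_glFiniteIntegralLevel n F) (π : Literature.NumberTheory.Automorphic.CuspidalAutomorphicRepData n F hcpt), π.1.IsRegularAlgebraic → ∀ (ι : PadicAlgCl p ≃+* ℂ) (k : Type) [Field k] [CharP k p] [IsAlgClosed k] [TopologicalSpace k] [DiscreteTopology k] (red : (Valued.v : Valuation (PadicAlgCl p) NNReal).valuationSubring →+* k), ∃ ρ : Literature.NumberTheory.GaloisRepresentations.FramedGaloisRep F k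 n, ∀ᶠ w in Filter.cofinite, ∀ α : Multiset ℂ, π.1.HasSatakeParamAt w α → ∃ P₀ : Polynomial (Valued.v : Valuation (PadicAlgCl p) NNReal).valuationSubring, P₀.map (Valued.v : Valuation (PadicAlgCl p) NNReal).valuationSubring.subtype = Literature.NumberTheory.Automorphic.arithFrobPolyOfSatake ι w.residueCard n α ∧ ρ.IsUnramifiedAt w ∧ ρ.HasFrobCharpolyAt w (P₀.map red)

/-- item stmt-Langlands-12171 · crux · rank 3 · open · by planner
why it might fail: l₀ = r₂(n−1) > 0: CG patching over F needs torsion Galois DETERMINANTS with local–global compatibility (CG Conj. B), far beyond T's 𝔽̄_p layer, and Smith theory has no ℤ/p² version; (B)_p needs Serre-modularity over M plus a non-perfectness criterion nobody has; irregular π over F untouched.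
sources: CalegariGeraghty2017, KhareThorne2017, ACCGHLNSTT2023, TreumannVenkatesh2016, CalegariVenkatesh2019, Scholze2015
[crux] L: T ⇒ for every (p, M, F) as in T there are reciprocity data 𝓡 for F such that for all n ≥ 1
and hcpt: (A) at ℓ = p — every L-algebraic cuspidal π of GL_n(𝔸_F) has, for every ι : ℚ̄_p ≃ ℂ, an
irreducible geometric ρ_{π,ι} : Γ_F → GL_n(ℚ̄_p) corresponding to π at every finite place, unique up
to conjugacy — and (B) at ℓ = p — every irreducible geometric p-adic ρ of Γ_F corresponds to an
L-algebraic cuspidal π. Foreseen mechanism: (A)_p for regular π by Calegari–Geraghty positive-defect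
patching over F (l₀ = r₂(n−1) > 0) with T and its torsion/family upgrade (CG Conjecture B over F) as
Galois input; (B)_p by residual automorphy over F via SMITH DESCENT — TV's equivariant isomorphism
H*_σ(X_{GL_{pn}/M}) ≅ H*_σ(X^σ), X^σ ⊇ X_{Res_{F/M}GL_n}: the eigensystem of Ind_F^M ρ̄, if
Serre-modular over the CM field M and with non-k[σ]-perfect localised complex (e.g. Euler
characteristic ≢ 0 mod p), occurs for GL_n/F — then R = 𝕋 over F; irregular L-algebraic π over F
have no cohomological avatar and are the open residue. [deps: ResidualGaloisRepKummer] [difficulty: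
open-problem] -/
@[route_item "route-Langlands-SmithKummerSeed", crux]
def KummerPrimeLifting : Prop :=
  (∀ (p : ℕ) [Fact p.Prime] (M F : Type) [Field M] [NumberField M] [Field F] [NumberField F] [Algebra M F] [IsGalois M F], (NumberField.IsTotallyReal M ∨ NumberField.IsCMField M) → (∃ ζ : M, IsPrimitiveRoot ζ p) → Module.finrank M F = p → ∀ (n : ℕ) (hcpt : Literature.NumberTheory.Automorphic.isCompact_glFiniteIntegralLevel n F) (π : Literature.NumberTheory.Automorphic.CuspidalAutomorphicRepData n F hcpt), π.1.IsRegularAlgebraic → ∀ (ι : PadicAlgCl p ≃+* ℂ) (k : Type) [Field k] [CharP k p] [IsAlgClosed k] [TopologicalSpace k] [DiscreteTopology k] (red : (Valued.v : Valuation (PadicAlgCl p) NNReal).valuationSubring →+* k), ∃ ρ : Literature.NumberTheory.GaloisRepresentations.FramedGaloisRep F k n, ∀ᶠ w in Filter.cofinite, ∀ α : Multiset ℂ, π.1.HasSatakeParamAt w α → ∃ P₀ : Polynomial (Valued.v : Valuation (PadicAlgCl p) NNReal).valuationSubring, P₀.map (Valued.v : Valuation (PadicAlgCl p) NNReal).valuationSubring.subtype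 = Literature.NumberTheory.Automorphic.arithFrobPolyOfSatake ι w.residueCard n α ∧ ρ.IsUnramifiedAt w ∧ ρ.HasFrobCharpolyAt w (P₀.map red)) → ∀ (p : ℕ) [Fact p.Prime] (M F : Type) [Field M] [NumberField M] [Field F] [NumberField F] [Algebra M F] [IsGalois M F], (NumberField.IsTotallyReal M ∨ NumberField.IsCMField M) → (∃ ζ : M, IsPrimitiveRoot ζ p) → Module.finrank M F = p → ∃ R : ReciprocityData F, ∀ n : ℕ, 0 < n → ∀ hcpt : Literature.NumberTheory.Automorphic.isCompact_glFiniteIntegralLevel n F, (∀ π : Literature.NumberTheory.Automorphic.CuspidalAutomorphicRepData n F hcpt, π.1.IsLAlgebraic → ∀ ι : PadicAlgCl p ≃+* ℂ, ∃ ρ : Literature.NumberTheory.GaloisRepresentations.FramedGaloisRep F (PadicAlgCl p) n, ρ.toGaloisRep.IsIrreducible ∧ IsGeometricFramed R ρ ∧ Corresponds R ι π.1 ρ ∧ ∀ ρ' : Literature.NumberTheory.GaloisRepresentations.FramedGaloisRep F (PadicAlgCl p) n, Corresponds R ι π.1 ρ' → IsConjugate ρ ρ') ∧ (∀ (ι :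 PadicAlgCl p ≃+* ℂ) (ρ : Literature.NumberTheory.GaloisRepresentations.FramedGaloisRep F (PadicAlgCl p) n), ρ.toGaloisRep.IsIrreducible → IsGeometricFramed R ρ → ∃ π : Literature.NumberTheory.Automorphic.CuspidalAutomorphicRepData n F hcpt, π.1.IsLAlgebraic ∧ Corresponds R ι π.1 ρ)

/-- item stmt-Langlands-12172 · crux · rank 4 · open · by planner
why it might fail: For ℓ ≠ [F:M] the only bridge to CM fields is induction to M, irregular by strong purity (arXiv:2207.03393 Prop. 2.6); potential automorphy cannot leave TR∪CM (subfields of CM fields are TR/CM), so no compatible system over F is constructible: as a reduction it may be exactly the non-regular core.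
sources: arXiv:2207.03393, Clozel1990, BarnetlambEtAl2014, ArthurClozelAMS120, HarrisLanTaylorThorneRMS2016, Taylor1994
[crux] S: p-adic reciprocity at the Kummer prime over every F ∈ 𝒦 (the conclusion of L) ⇒ full
reciprocity over every F ∈ 𝒦: ∃ 𝓡, ∀ n ≥ 1, ∀ hcpt, GlobalLanglandsCorrespondenceGLn n F 𝓡 hcpt.
Content for ℓ ≠ [F:M]: ℓ-adic Galois representations (and the converse direction) for the
Kummer-MONOMIAL irregular cuspidal representations Π = AI_{F/M}(π) of GL_{pn}(𝔸_M) (Π ≅ Π ⊗ η_{F/M};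
by strong purity the weights of π descend from M, so Π_∞ repeats each Hodge–Tate weight p times),
followed by restriction to Γ_F and Clifford de-induction over twists; n = 1 is class field theory +
Weil (algebraic Hecke characters of F factor through M up to finite order). For F CM (p = 2) it
contains reciprocity over CM fields in all weights. [deps: KummerPrimeLifting] [difficulty:
open-problem] -/
@[route_item "route-Langlands-SmithKummerSeed", crux]
def KummerPrimeToAllPrimes : Prop :=
  (∀ (p : ℕ) [Fact p.Prime] (M F : Type) [Field M] [NumberField M] [Field F] [NumberField F] [Algebra M F] [IsGalois M F], (NumberField.IsTotallyReal M ∨ NumberField.IsCMField M) → (∃ ζ : M, IsPrimitiveRoot ζ p) → Module.finrank M F = p → ∃ R : ReciprocityData F, ∀ n : ℕ, 0 < n → ∀ hcpt : Literature.NumberTheory.Automorphic.isCompact_glFiniteIntegralLevel n F, (∀ π : Literature.NumberTheory.Automorphic.CuspidalAutomorphicRepData n F hcpt, π.1.IsLAlgebraic → ∀ ι : PadicAlgCl p ≃+* ℂ, ∃ ρ : Literature.NumberTheory.GaloisRepresentations.FramedGaloisRep F (PadicAlgCl p) n, ρ.toGaloisRep.IsIrreducible ∧ IsGeometricFramed R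 ρ ∧ Corresponds R ι π.1 ρ ∧ ∀ ρ' : Literature.NumberTheory.GaloisRepresentations.FramedGaloisRep F (PadicAlgCl p) n, Corresponds R ι π.1 ρ' → IsConjugate ρ ρ') ∧ (∀ (ι : PadicAlgCl p ≃+* ℂ) (ρ : Literature.NumberTheory.GaloisRepresentations.FramedGaloisRep F (PadicAlgCl p) n), ρ.toGaloisRep.IsIrreducible → IsGeometricFramed R ρ → ∃ π : Literature.NumberTheory.Automorphic.CuspidalAutomorphicRepData n F hcpt, π.1.IsLAlgebraic ∧ Corresponds R ι π.1 ρ)) → ∀ (p : ℕ) [Fact p.Prime] (M F : Type) [Field M] [NumberField M] [Field F] [NumberField F] [Algebra M F] [IsGalois M F], (NumberField.IsTotallyReal M ∨ NumberField.IsCMField M) → (∃ ζ : M, IsPrimitiveRoot ζ p) → Module.finrank M F = p → ∃ R : ReciprocityData F, ∀ n : ℕ, 0 < n → ∀ hcpt : Literature.NumberTheory.Automorphic.isCompact_glFiniteIntegralLevel n F, GlobalLanglandsCorrespondenceGLn n F R hcpt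

/-- item stmt-Langlands-1094 · crux · rank 5 · open · by planner
why it might fail: Non-normal layers (pure cubics…) need non-normal solvable BC/descent: the twist/extension ambiguity at non-split places is not resolvable without reciprocity over an intermediate non-TR/CM field (circular). Known for cubic GL_2 only (JPSS; image/fibres subtle: Lapid–Rogawski, Rajan); AC p.191.
sources: ArthurClozelAMS120, doi:10.4310/mrl.2002.v9.n4.a9, doi:10.1515/form.10.2.175, Taylor1994, BoxerEtAl2021
[crux] Reciprocity over TR∪CM ⇒ reciprocity over every CONJUGATION-SOLVABLE F (typed inline: ∃
totally real F₀ and a finite Galois E ⊇ F ⊇ F₀ with IsSolvable (E ≃ₐ[F₀] E); equivalently the Galois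
closure of F over its maximal totally real subfield is solvable — TR, CM, any quadratic extension of
a TR field, pure cubics, every F with [F:F^tr] ≤ 4). Mechanism (card conjugation-solvable-fields,
T_α): UP-steps along cyclic prime layers by Arthur–Clozel AI/BC (tree: exists_baseChange_cyclic,
ArthurClozel1989_inducedLift_of_twist_eq, _fibres_of_baseChange) + Clifford theory + de-induction
over a Zariski-dense family of twists π⊗χ (Taylor1994, Mok, BCGP §2.7: n=2 any quadratic over TR),
DOWN-steps by cyclic descent (ArthurClozel1989_cuspidal_descent); direction (B) by Jordan–Hölder
matching of isobaric sums across layers using the lower field's reciprocity + AC 4.2(b). The TR∪CM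
input is consumed in IRREGULAR weight (strong purity: every induced object over F₁ is
Hodge-irregular). -/
@[route_item "route-Langlands-SmithKummerSeed", crux]
def AscentConjugationSolvable : Prop :=
  (∀ (F : Type) [Field F] [NumberField F], (NumberField.IsTotallyReal F ∨ NumberField.IsCMField F) → ∃ R : ReciprocityData F, ∀ n : ℕ, 0 < n → ∀ hcpt : Literature.NumberTheory.Automorphic.isCompact_glFiniteIntegralLevel n F, GlobalLanglandsCorrespondenceGLn n F R hcpt) → ∀ (F : Type) [Field F] [NumberField F], (∃ (F₀ E : Type) (_ : Field F₀) (_ : NumberField F₀) (_ : Field E) (_ : NumberField E) (_ : Algebra F₀ F) (_ : Algebra F E) (_ : Algebra F₀ E) (_ : IsScalarTower F₀ F E) (_ : IsGalois F₀ E), NumberField.IsTotallyReal F₀ ∧ IsSolvable (E ≃ₐ[F₀] E)) → ∃ R : ReciprocityData F, ∀ n : ℕ, 0 < n → ∀ hcpt : Literature.NumberTheory.Automorphic.isCompact_glFiniteIntegralLevel n F, GlobalLanglandsCorrespondenceGLn n F R hcpt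

/-- item stmt-Langlands-18032 · crux · rank 5 · open · by planner
why it might fail: Theorem in print (Arthur–Clozel III.4.2(d), PRIME degree; AC's slip was the non-prime cyclic case, Clozel–Rajan 2020), no L-function proof: XL twisted trace formula. As typed only drift bites: free |det|^s twist of Borel–Jacquet data (clean models; ∀cuspidal_W'_eq_bot refuted), a.e. shadow of Π≅Π^σ.
sources: ArthurClozelAMS120 Ch. 3 Thm 4.2 (d) (book p. 203; held book:arthur1989-simple-algebras-base-change-advanced-theory-trace, chunks 173/177), LanglandsBaseChange1980, JacquetShalika1981 Thm 4.4, arXiv:1806.02513 p.3 (Clozel–Rajan, Solvable base change, doi:10.1515/crelle-2020-0023), doi:10.1515/form.10.2.175 (Lapid–Rogawski 1998), Literature.NumberTheory.Automorphic.cuspidal_descent_cyclic (verbatim body; Iff.rfl)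
[crux] ARTHUR–CLOZEL CUSPIDAL DESCENT OF PRIME DEGREE (route-choice 046b9f1f, 2026-08-17: PROMOTION
of the XL-apex Literature fact `Literature.NumberTheory.Automorphic.cuspidal_descent_cyclic`,
VERBATIM with its two predicates IsGaloisStableSatakeAE / IsWeakBaseChangeLiftAE unfolded —
`Iff.rfl` against the fact, planner SketchIff.lean rc 0). For E/F cyclic of prime degree and a
cuspidal Π on GL_n(𝔸_E) (Borel–Jacquet datum CuspidalAutomorphicRepData) whose Satake data are
Gal(E/F)-stable a.e. (IsGaloisStableSatakeAE, the shadow of Π ≅ Π∘σ, equivalent to it by strong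
multiplicity one) there is a cuspidal π on GL_n(𝔸_F) of which Π is a weak base-change lift
(IsWeakBaseChangeLiftAE: t_{Π,w} = t_{π,v}^{f(w|v)} a.e.). Arthur–Clozel 1989 Ch. 3 Thm 4.2 (d),
existence clause (held copy chunk 173; proof chunk 177: 'the identity of (4.1) with (4.2) shows the
existence' = the twisted trace formula comparison, Ch. 2 Thms A–B; no L-function proof of descent is
known). LOAD-BEARING HERE: (i) crux #2 ReciprocityTRCM, line `pieces` (lead
prover-line-stmt-Langlands-1093-0) — conjunct 1 of the registered stub stub_arthurClozelDescentFacts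
and hypothesis 1 of the LANDED stubs stub_quadraticDescentLAlg -/
@[route_item "route-Langlands-SmithKummerSeed"]
def ArthurClozelCuspidalDescent : Prop :=
  ∀ (n : ℕ) (F E : Type) [Field F] [NumberField F] [Field E] [NumberField E] [Algebra F E] [IsGalois F E] (hF : Literature.NumberTheory.Automorphic.isCompact_glFiniteIntegralLevel n F) (hE : Literature.NumberTheory.Automorphic.isCompact_glFiniteIntegralLevel n E), IsCyclic (E ≃ₐ[F] E) → (Module.finrank F E).Prime → ∀ P : Literature.NumberTheory.Automorphic.CuspidalAutomorphicRepData n E hE, (∀ᶠ w : IsDedekindDomain.HeightOneSpectrum (NumberField.RingOfIntegers E) in Filter.cofinite, ∀ w' : IsDedekindDomain.HeightOneSpectrum (NumberField.RingOfIntegers E), w'.asIdeal.under (NumberField.RingOfIntegers F) = w.asIdeal.under (NumberField.RingOfIntegers F) → ∀ α : Multiset ℂ, P.1.HasSatakeParamAt w α → P.1.HasSatakeParamAt w' α) → ∃ π : Literature.NumberTheory.Automorphic.CuspidalAutomorphicRepData n F hF, ∀ᶠ w : IsDedekindDomain.HeightOneSpectrum (NumberField.RingOfIntegers E) in Filter.cofinite,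 ∀ (v : IsDedekindDomain.HeightOneSpectrum (NumberField.RingOfIntegers F)) (α : Multiset ℂ), w.asIdeal.under (NumberField.RingOfIntegers F) = v.asIdeal → π.1.HasSatakeParamAt v α → P.1.HasSatakeParamAt w (α.map (· ^ w.asIdeal.inertiaDeg (NumberField.RingOfIntegers F)))

/-- item stmt-Langlands-18645 · crux · rank 5 · open · by planner
why it might fail: As a reduction it may equal non-normal solvable base change for GL_n (open beyond n=1 / cubic GL_2, JPSS 1981): at inert places BC(π) fixes only p-th powers of Satake parameters, the p candidate descents ρ⊗η^j cannot be compared with π without (A) over K; patching over auxiliary K·M is circular.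
sources: ArthurClozelAMS120 Ch. 3 Thm 4.2, Thm 6.2, closing remark p.191, JPSS1981Cubique, Lapid1998 §1 (doi:10.4171/dm/45), doi:10.4310/mrl.2002.v9.n4.a9 (Rajan 2002, Thms 1-2), doi:10.1515/form.10.2.175 (Lapid–Rogawski 1998), LanglandsBaseChange1980 §3
[crux] DOWN-STEP of AscentConjugationSolvable (crux-strategist split, piece 2 of 2; the OPEN core):
for every Galois extension of number fields L/K of PRIME degree (hence cyclic), full reciprocity for
GL_n over L (both directions, every finite place, all n; the summit's body for L) implies full
reciprocity over K. Direction (B) over K is theorem-level given (A) over K: ρ|Γ_L ↔ Π by (B)_L, Π^σ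
≅ Π ⇒ Π = BC(π) by Arthur–Clozel cyclic descent (tree: ArthurClozel1989_cuspidal_descent,
exists_baseChange_cyclic) or ρ ≅ Ind τ ⇒ AI(π_τ) cuspidal (automorphicInduction_cyclic_cuspidal),
then ρ ≅ ρ_{π⊗η^j} by (A)_K + Chebotarev/Brauer–Nesbitt + Clifford, and Corresponds transports along
conjugacy (pattern of LiftDescend.SolvableDescentOfAutomorphy / WeakToStrongGalToAut). Direction (A)
over K is the open residue named in the parent's why-might-fail: π cuspidal L-algebraic over K,
ρ_{BC(π)} over L exists and is σ-invariant, extends to Γ_K in p ways (irreducible case; Clifford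
otherwise), and ONE extension must match π at the INERT places (where BC only sees p-th powers of
Satake parameters) with local–global compatibility at every place relative to some reciprocity data
for K — solvable NON-NO -/
@[route_item "route-Langlands-SmithKummerSeed", crux]
def CyclicPrimeDescent : Prop :=
  ∀ (K L : Type) [Field K] [NumberField K] [Field L] [NumberField L] [Algebra K L] [IsGalois K L], (Module.finrank K L).Prime → (∃ R : ReciprocityData L, ∀ n : ℕ, 0 < n → ∀ hcpt : Literature.NumberTheory.Automorphic.isCompact_glFiniteIntegralLevel n L, GlobalLanglandsCorrespondenceGLn n L R hcpt) → ∃ R : ReciprocityData K, ∀ n : ℕ, 0 < n → ∀ hcpt : Literature.NumberTheory.Automorphic.isCompact_glFiniteIntegralLevel n K, GlobalLanglandsCorrespondenceGLn n K R hcpt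

/-- item stmt-Langlands-19599 · crux · rank 5 · open · by planner
why it might fail: Theorem in print (Arthur–Clozel III.4.2(a), PRIME degree; n=2 Langlands 1980); no L-function proof: XL twisted trace formula (tree: reduced to the L² leaf ArthurClozel1989_weakLifting_cuspidal + multiplicity_one_gl_holds). As typed only drift bites: free |det|^s twist of BJ data, weak lift a.e.
sources: ArthurClozelAMS120 Ch. 3 Thm 4.2 (a), Def. 1.1, proof of Thm 3.1 (held book:arthur1989-simple-algebras-base-change-advanced-theory-trace p0173 L13-15; proof p0174-0176), LanglandsBaseChange1980, arXiv:1806.02513 (Clozel–Rajan, Solvable base change, doi:10.1515/crelle-2020-0023), doi:10.1515/form.10.2.175 (Lapid–Rogawski 1998), Literature.NumberTheory.Automorphic.baseChange_cyclic_cuspidal (verbatim body; Iff.rfl, SketchIff.lean rc 0, crux probe CLEAN), Literature.NumberTheory.Automorphic.baseChange_cyclic_cuspidal_of_weakLifting + multiplicity_one_gl_holds (tree reduction to the L² leaf)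
[crux] ARTHUR–CLOZEL CUSPIDAL BASE CHANGE OF PRIME DEGREE (route-choice rchoice 2f2042a4,
2026-08-17: PROMOTION of the XL-apex Literature fact
`Literature.NumberTheory.Automorphic.baseChange_cyclic_cuspidal`, VERBATIM and fully qualified,
`IsWeakBaseChangeLiftAE` unfolded by its Iff.rfl lemma — Iff.rfl against the fact, planner
SketchIff.lean rc 0, #h21_crux_probe CLEAN). For E/F Galois of PRIME degree l (hence cyclic) and a
cuspidal π on GL_n(𝔸_F) with ONE place v inert in E (w ∣ v of residue degree l) and a Satake
parameter α at v with ζ•α ≠ α for every primitive l-th root of unity ζ (local shadow of the printed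
π ≇ π⊗η: t_{π⊗η,v} = η(ϖ_v)·t_{π,v}, η(ϖ_v) primitive at inert v, AC proof of Thm 3.1) there is, for
every level datum hE, a CUSPIDAL P on GL_n(𝔸_E) which is a weak base-change lift of π (t_{P,w} =
t_{π,v}^{f(w|v)} a.e.). Arthur–Clozel 1989 Ch. 3 Thm 4.2 (a) with Def. 1.1 (held copy p0173 L13–15:
'(a) Assume π is cuspidal, π ≢ π⊗η. Then there is a unique σ-stable Π lifting π; Π is cuspidal';
proof p0174 L25–p0176 = twisted trace formula comparison (4.1)=(4.2); n = 2 is Langlands 1980).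
LOAD-BEARING HERE: the UP-step of crux AscentConjugationSolvable (stmt-Langlands-1094; -/
@[route_item "route-Langlands-SmithKummerSeed"]
def ArthurClozelCuspidalBaseChange : Prop :=
  ∀ (n : ℕ) (F E : Type) [Field F] [NumberField F] [Field E] [NumberField E] [Algebra F E] [IsGalois F E], (Module.finrank F E).Prime → ∀ (hF : Literature.NumberTheory.Automorphic.isCompact_glFiniteIntegralLevel n F) (π : Literature.NumberTheory.Automorphic.CuspidalAutomorphicRepData n F hF), (∃ (v : IsDedekindDomain.HeightOneSpectrum (NumberField.RingOfIntegers F)) (w : IsDedekindDomain.HeightOneSpectrum (NumberField.RingOfIntegers E)) (α : Multiset ℂ), w.asIdeal.under (NumberField.RingOfIntegers F) = v.asIdeal ∧ w.asIdeal.inertiaDeg (NumberField.RingOfIntegers F) = Module.finrank F E ∧ π.1.HasSatakeParamAt v α ∧ ∀ ζ : ℂ, IsPrimitiveRoot ζ (Module.finrank F E) → α.map (ζ * ·) ≠ α) → ∀ (hE : Literature.NumberTheory.Automorphic.isCompact_glFiniteIntegralLevel n E), ∃ P : Literature.NumberTheory.Automorphic.CuspidalAutomorphicRepData n E hE, ∀ᶠ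 w : IsDedekindDomain.HeightOneSpectrum (NumberField.RingOfIntegers E) in Filter.cofinite, ∀ (v : IsDedekindDomain.HeightOneSpectrum (NumberField.RingOfIntegers F)) (α : Multiset ℂ), w.asIdeal.under (NumberField.RingOfIntegers F) = v.asIdeal → π.1.HasSatakeParamAt v α → P.1.HasSatakeParamAt w (α.map (· ^ w.asIdeal.inertiaDeg (NumberField.RingOfIntegers F)))

/-- item stmt-Langlands-1095 · crux · rank 6 · open · by planner
why it might fail: Needs GL_n BC/AI/descent along simple non-abelian Galois layers: no trace-formula comparison exists (GetzHahn2024 §13.4 'unavailable'; Getz2012 conditional, SL₂(𝔽₅) only); Galois-theoretic insoluble BC needs a TR/CM top field, excluded here; may be no easier than the summit.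
sources: Getz2012Nonsolvable, GetzHahn2024, Calegari2023, ArthurClozelAMS120
[crux] Reciprocity over all conjugation-solvable fields ⇒ reciprocity over ALL number fields. The
residual class ([F:F^tr] ≥ 5 with insoluble conjugation-closure, e.g. an S₅-quintic with complex
places) is one functoriality away (card T_β): base change + automorphic induction + descent for GL_n
along Galois extensions with SIMPLE non-abelian group (every finite group has a subnormal series
with cyclic or simple factors), then the same bookkeeping as AscentConjugationSolvable. Typed as the
bare implication; the functoriality hypotheses become separate items once a Literature predicate for
non-cyclic base change / automorphic induction exists (definition request filed with this route). -/
@[route_item "route-Langlands-SmithKummerSeed", crux]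
def AscentResidual : Prop :=
  (∀ (F : Type) [Field F] [NumberField F], (∃ (F₀ E : Type) (_ : Field F₀) (_ : NumberField F₀) (_ : Field E) (_ : NumberField E) (_ : Algebra F₀ F) (_ : Algebra F E) (_ : Algebra F₀ E) (_ : IsScalarTower F₀ F E) (_ : IsGalois F₀ E), NumberField.IsTotallyReal F₀ ∧ IsSolvable (E ≃ₐ[F₀] E)) → ∃ R : ReciprocityData F, ∀ n : ℕ, 0 < n → ∀ hcpt : Literature.NumberTheory.Automorphic.isCompact_glFiniteIntegralLevel n F, GlobalLanglandsCorrespondenceGLn n F R hcpt) → ∀ (F : Type) [Field F] [NumberField F], ∃ R : ReciprocityData F, ∀ n : ℕ, 0 < n → ∀ hcpt : Literature.NumberTheory.Automorphic.isCompact_glFiniteIntegralLevel n F, GlobalLanglandsCorrespondenceGLn n F R hcpt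

/-- item stmt-Langlands-19458 · crux · rank 6 · open · by planner
why it might fail: (A) over L = Galois reps for GL_n over a non-TR, non-CM field with no functorial link to K: no known method (Shimura-variety barrier; non-solvable BC 'unavailable', GetzHahn2024 p.259); (B)-half via converse theorems needs (A)_L in lower rank + an archimedean clause the typed summit lacks.
sources: GetzHahn2024 §13.4 p.259 (corpus book:getz2024 PDF p.275: 'base change for nonsolvable extensions is unavailable'), Getz2012Nonsolvable (arXiv:1701.01766; corpus paper:arxiv-1701.01766 p.2 abstract), ArthurClozelAMS120 Ch. 3 (solvable/cyclic only), BarnetlambEtAl2014 §5 (solvable descent of automorphy only), Literature.Barriers.Langlands.SolvableImageBarrier, Literature.Barriers.Langlands.ShimuraVarietyRealizationBarrier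
[crux] TOP-LAYER UP-STEP of AscentResidual (crux-strategist r1 split of stmt-Langlands-1095, piece 3
of 4; verbatim the registered stub `stub_simpleAscent` of Cruxes/AscentResidual/Lines/birth.lean):
for every Galois extension of number fields L/K whose group Gal(L/K) is NON-ABELIAN SIMPLE, full
reciprocity for GL_n over K (both directions (A),(B), every finite place, all n ≥ 1, ∃-currency)
implies full reciprocity over L. THIS IS WHERE THE PARENT'S OPEN CORE LIVES: for the complex
A5-closure L/ℚ the only conjugation-solvable subfield of L is ℚ (totally real subfields ⇔ subgroups
containing the normal closure of complex conjugation = A5), so there the parent reads Rec(ℚ) ⇒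
Rec(L) (lead's minimality certificate PROMOTE.md, GAP job j024775). The two directions are
ASYMMETRIC. (A) over L (Galois representations for L-algebraic cuspidal π′ of GL_n(𝔸_L), L neither
totally real nor CM, no functorial transfer to K available: AI needs L/K cyclic, BC along
non-solvable L/K is 'unavailable' — GetzHahn2024 §13.4 p.259; Getz2012 reduces it to conjectural
trace identities) is a verbatim special case of the summit's direction (A) over general number
fields, and the hypothesis Rec(K) gives no kno -/
@[route_item "route-Langlands-SmithKummerSeed", crux]
def SimpleLayerAscent : Prop :=
  ∀ (K L : Type) [Field K] [NumberField K] [Field L] [NumberField L] [Algebra K L] [IsGalois K L], IsSimpleGroup (L ≃ₐ[K] L) → ¬ IsSolvable (L ≃ₐ[K] L) → (∃ R : ReciprocityData K, ∀ n : ℕ, 0 < n → ∀ hcpt : Literature.NumberTheory.Automorphic.isCompact_glFiniteIntegralLevel n K, GlobalLanglandsCorrespondenceGLn n K R hcpt) → ∃ R : ReciprocityData L, ∀ n : ℕ, 0 < n → ∀ hcpt : Literature.NumberTheory.Automorphic.isCompact_glFiniteIntegralLevel n L, GlobalLanglandsCorrespondenceGLn n L R hcpt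

/-- item stmt-Langlands-18649 · crux · rank 7 · open · by planner
why it might fail: True if the summit is; as a FUNCTORIAL reduction it needs rec-compatibility with local BC/AI at ramified v and v∣ℓ, but the ∃R witness over K may be exotic (LocalLanglandsDatum not provably unique in tree; Henniart ε-of-pairs characterisation needed); de-induction eats (A)_K in irregular weight.
sources: ArthurClozelAMS120 Ch. 3 Thm 4.2, Thm 5.1, Thm 6.2, Henniart2012, HenniartHerb1995, Taylor1994 §3, Mok2014 §5, BoxerEtAl2021 §2.7
[crux] UP-STEP of AscentConjugationSolvable (crux-strategist split, piece 1 of 2; known technique,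
Lean-heavy): for every Galois extension of number fields L/K of PRIME degree (hence cyclic), full
reciprocity for GL_n over K (both directions, every finite place, all n) implies full reciprocity
over L. Direction (A) over L: π′ cuspidal L-algebraic over L; AI_{L/K}(π′ ⊗ χ) for finite-order
Hecke characters χ of L is isobaric automorphic over K (Arthur–Clozel Ch. 3 Thm 6.2 / Henniart
2012), L-algebraic; (A)_K on its cuspidal constituents (IRREGULAR weight in general: the hypothesis
supplies all weights); extraction of ρ_{π′} by Clifford theory and de-induction over a separating
family of twists (Taylor 1994 §3; the tree's PROVED QuadraticWindow.TwistUnpackaging is the p = 2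
instance of the a.e. extraction), local–global compatibility at every place of L transferred from K
through the compatibility of rec with cyclic base change / automorphic induction (Arthur–Clozel Ch.
1, Henniart–Herb 1995), de Rhamness by restriction, uniqueness by Chebotarev + Brauer–Nesbitt.
Direction (B) over L: Ind_L^K ρ′ is semisimple geometric, its irreducible constituents are
cuspidal-automorphic over K by ( -/
@[route_item "route-Langlands-SmithKummerSeed", crux]
def CyclicPrimeAscent : Prop :=
  ∀ (K L : Type) [Field K] [NumberField K] [Field L] [NumberField L] [Algebra K L] [IsGalois K L], (Module.finrank K L).Prime → (∃ R : ReciprocityData K, ∀ n : ℕ, 0 < n → ∀ hcpt : Literature.NumberTheory.Automorphic.isCompact_glFiniteIntegralLevel n K, GlobalLanglandsCorrespondenceGLn n K R hcpt) → ∃ R : ReciprocityData L, ∀ n : ℕ, 0 < n → ∀ hcpt : Literature.NumberTheory.Automorphic.isCompact_glFiniteIntegralLevel n L, GlobalLanglandsCorrespondenceGLn n L R hcpt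

/-- item stmt-Langlands-19462 · crux · rank 8 · open · by planner
why it might fail: Needs NON-SOLVABLE descent for GL_n (open; Getz2012 only reduces it to conjectural trace identities): (B) over K contains strong Artin for ρ with non-solvable image Gal(L/K), K arbitrary (known only n=2, odd, TR); (A) over K must extend ρ_{BC π} from Γ_L to Γ_K with BC itself missing.
sources: GetzHahn2024 §13.4 p.259 (corpus book:getz2024 PDF p.275: 'base change for nonsolvable extensions is unavailable'), Getz2012Nonsolvable (arXiv:1701.01766; corpus paper:arxiv-1701.01766 p.2 abstract), ArthurClozelAMS120 Ch. 3 (solvable/cyclic only), BarnetlambEtAl2014 §5 (solvable descent of automorphy only), Literature.Barriers.Langlands.SolvableImageBarrier, Literature.Barriers.Langlands.ShimuraVarietyRealizationBarrier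
[crux] TOP-LAYER DOWN-STEP of AscentResidual (crux-strategist r1 split of stmt-Langlands-1095, piece
4 of 4; verbatim the registered stub `stub_simpleDescent` of
Cruxes/AscentResidual/Lines/birth.lean): for every Galois extension of number fields L/K whose group
is NON-ABELIAN SIMPLE, full reciprocity for GL_n over L implies full reciprocity over K
(∃-currency). In the parent's assembly (numberField_induction_simpleLayers, landed p151576) K is an
intermediate field of the strong induction on [K:ℚ] and L = K·M for a minimal normal non-abelian
layer of the Galois closure, so K is arbitrary (not totally real in general). NON-SOLVABLE DESCENT,
both halves open as typed: (B) over K contains the strong Artin conjecture for irreducible ρ :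
Gal(L/K) → GL_n(ℂ) with non-solvable image (geometric of finite image; automorphy of ρ|_L is
trivial, descent to K is the whole content) — known only for n = 2, ρ odd, K totally real
(Pilloni–Stroh, Sasaki; GetzHahn2024 Thm 13.4.6) and open for even ρ or general K (icosahedral
Artin); (A) over K: π cuspidal L-algebraic over K; without base change BC_{L/K}(π) ('unavailable'
for non-solvable L/K, GetzHahn2024 p.259; Getz2012 = conjectural trace identities -/
@[route_item "route-Langlands-SmithKummerSeed", crux]
def SimpleLayerDescent : Prop :=
  ∀ (K L : Type) [Field K] [NumberField K] [Field L] [NumberField L] [Algebra K L] [IsGalois K L], IsSimpleGroup (L ≃ₐ[K] L) → ¬ IsSolvable (L ≃ₐ[K] L) → (∃ R : ReciprocityData L, ∀ n : ℕ, 0 < n → ∀ hcpt : Literature.NumberTheory.Automorphic.isCompact_glFiniteIntegralLevel n L, GlobalLanglandsCorrespondenceGLn n L R hcpt) → ∃ R : ReciprocityData K, ∀ n : ℕ, 0 < n → ∀ hcpt : Literature.NumberTheory.Automorphic.isCompact_glFiniteIntegralLevel n K, GlobalLanglandsCorrespondenceGLn n K R hcpt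

/-- item stmt-Langlands-1096 · support · rank 9 · open · by planner
sources: Sorensen2020, ArthurClozelAMS120, BarnetlambEtAl2014
[support] Reciprocity over all CM fields ⇒ over all totally real fields: (A) by Sorensen patching
over the S-general family of imaginary-quadratic composita FK_i (π ↦ BC_{FK_i/F}(π) cuspidal for all
but finitely many K_i; ρ_i from (A) over FK_i; tree PatchingLemma/SorensenPatching; LGC and de
Rhamness transferred from a K_i splitting v); (B) by quadratic descent of automorphy given (A) over
F (choose K with ρ|_{FK} irreducible — all but finitely many — then Π^c≅Π ⇒ Π = BC(π) by
Arthur–Clozel ⇒ ρ ≅ ρ_π⊗χ). Theorem-level; shared with route CMFern. -/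
@[route_item "route-Langlands-SmithKummerSeed", crux]
def ReciprocityCMtoTR : Prop :=
  (∀ (F : Type) [Field F] [NumberField F], NumberField.IsCMField F → ∃ R : ReciprocityData F, ∀ n : ℕ, 0 < n → ∀ hcpt : Literature.NumberTheory.Automorphic.isCompact_glFiniteIntegralLevel n F, GlobalLanglandsCorrespondenceGLn n F R hcpt) → ∀ (F : Type) [Field F] [NumberField F], NumberField.IsTotallyReal F → ∃ R : ReciprocityData F, ∀ n : ℕ, 0 < n → ∀ hcpt : Literature.NumberTheory.Automorphic.isCompact_glFiniteIntegralLevel n F, GlobalLanglandsCorrespondenceGLn n F R hcpt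

/-- item stmt-Langlands-12173 · support · rank 9 · open · by planner
sources: TreumannVenkatesh2016, Scholze2015, Ash2003, Feng2024, arXiv:2312.12542
[support] foreseen child X1 of T (retired route's stmt-Langlands-2676, verbatim): in the setting of
T the Frobenius polynomials of π at w ∤ p have integral models P₀(w), and for every mod-p character
χ of Γ_F with Frobenius values c there is R_χ : Γ_M → GL_{pn}(k) with charpoly((R_χ|Γ_F)(Frob_w)) =
∏_{g ∈ Gal(F/M)} red(P₀(g·w)).scaleRoots(c(g·w)) for almost all w — the Galois shadow of
Smith-theoretic automorphic induction of (π mod p) ⊗ χ: TV First Main Theorem for (GL_{pn}/M, Ad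
a^{1/p}) (or SL_{pn} + central bookkeeping) on the trivial-weight deeper-level avatar of π ⊗ χ̃,
Brauer–Satake = induction (all √q-twists trivial since q_v ≡ 1 mod p), Scholze2015 V.4.1 (m = 1)
over M as a named-fact hypothesis, Ind/restriction dictionary `hasFrobCharpolyAt_outerConj_iff`.
[deps: CliffordExtractionModP] [difficulty: XL] [difficulty: XL] -/
@[route_item "route-Langlands-SmithKummerSeed"]
def ResidualInductionKummer : Prop :=
  ∀ (p : ℕ) [Fact p.Prime] (M F : Type) [Field M] [NumberField M] [Field F] [NumberField F] [Algebra M F] [IsGalois M F], (NumberField.IsTotallyReal M ∨ NumberField.IsCMField M) → (∃ ζ : M, IsPrimitiveRoot ζ p) → Module.finrank M F = p → ∀ (n : ℕ) (hcpt : Literature.NumberTheory.Automorphic.isCompact_glFiniteIntegralLevel n F) (π : Literature.NumberTheory.Automorphic.CuspidalAutomorphicRepData n F hcpt), π.1.IsRegularAlgebraic → ∀ (ι : PadicAlgCl p ≃+* ℂ) (k : Type) [Field k] [CharP k p] [IsAlgClosed k] [TopologicalSpace k] [DiscreteTopology k] (red : (Valued.v : Valuation (PadicAlgCl p) NNReal).valuationSubring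 →+* k), ∃ P₀ : IsDedekindDomain.HeightOneSpectrum (NumberField.RingOfIntegers F) → Polynomial (Valued.v : Valuation (PadicAlgCl p) NNReal).valuationSubring, (∀ (w : IsDedekindDomain.HeightOneSpectrum (NumberField.RingOfIntegers F)) (α : Multiset ℂ), π.1.HasSatakeParamAt w α → ((p : ℕ) : NumberField.RingOfIntegers F) ∉ w.asIdeal → (P₀ w).map (Valued.v : Valuation (PadicAlgCl p) NNReal).valuationSubring.subtype = Literature.NumberTheory.Automorphic.arithFrobPolyOfSatake ι w.residueCard n α) ∧ ∀ (χ : Literature.NumberTheory.GaloisRepresentations.FramedGaloisRep F k 1) (c : IsDedekindDomain.HeightOneSpectrum (NumberField.RingOfIntegers F) → k), (∀ᶠ w in Filter.cofinite, χ.HasFrobCharpolyAt w (Polynomial.X - Polynomial.C (c w))) → ∃ R : Literature.NumberTheory.GaloisRepresentations.FramedGaloisRep M k (p * n), ∀ᶠ w in Filter.cofinite, (R.restrictField F).HasFrobCharpolyAt w (∏ᶠ g : F ≃ₐ[M] F, ((P₀ (g • w)).map red).scaleRoots (c (g • w)))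

/-- item stmt-Langlands-12174 · support · rank 9 · open · by planner
sources: SerreLinearRepresentations1977, ChenevierHarris2013, Sorensen2020, TreumannVenkatesh2016
[support] foreseen child X2 of T (retired route's stmt-Langlands-2675, verbatim; pure Galois theory,
prover-ready): F/M Galois of prime degree p = char k, k algebraically closed discrete, P : places of
F → k[X] monic of degree n a.e.; IF for every continuous character χ : Γ_F → k^× (Frobenius values c
a.e.) there is R_χ : Γ_M → GL_{pn}(k) whose restriction to Γ_F has charpoly(Frob_w) = ∏_{g ∈
Gal(F/M)} P(g·w).scaleRoots(c(g·w)) a.e., THEN there is τ : Γ_F → GL_n(k) with charpoly τ(Frob_w) =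
P(w) a.e. Tools in tree: AbsGaloisOuterConj, RestrictFieldSemisimple, FrobeniusDensityTheorem,
LAdicRepFrobenius (Brauer–Nesbitt). Hand-checked n = 1, p = 2. X1 → X2 → T is bookkeeping in tree
(the retired route's assembly). [difficulty: L] [difficulty: L] -/
@[route_item "route-Langlands-SmithKummerSeed"]
def CliffordExtractionModP : Prop :=
  ∀ (p : ℕ) [Fact p.Prime] (M F : Type) [Field M] [NumberField M] [Field F] [NumberField F] [Algebra M F] [IsGalois M F], Module.finrank M F = p → ∀ (k : Type) [Field k] [CharP k p] [IsAlgClosed k] [TopologicalSpace k] [DiscreteTopology k] (n : ℕ) (P : IsDedekindDomain.HeightOneSpectrum (NumberField.RingOfIntegers F) → Polynomial k), (∀ᶠ w in Filter.cofinite, (P w).Monic ∧ (P w).natDegree = n) → (∀ (χ : Literature.NumberTheory.GaloisRepresentations.FramedGaloisRep F k 1) (c : IsDedekindDomain.HeightOneSpectrum (NumberField.RingOfIntegers F) → k), (∀ᶠ w in Filter.cofinite, χ.HasFrobCharpolyAt w (Polynomial.X - Polynomial.C (c w))) → ∃ R : Literature.NumberTheory.GaloisRepresentations.FramedGaloisRep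 M k (p * n), ∀ᶠ w in Filter.cofinite, (R.restrictField F).HasFrobCharpolyAt w (∏ᶠ g : F ≃ₐ[M] F, (P (g • w)).scaleRoots (c (g • w)))) → ∃ τ : Literature.NumberTheory.GaloisRepresentations.FramedGaloisRep F k n, ∀ᶠ w in Filter.cofinite, τ.HasFrobCharpolyAt w (P w)

-- item stmt-Langlands-12655 · support · rank 9 · open · by planner — informal only, no Lean statement yet:
--   [support] BrauerSatakeIsInduction — the make-or-break local computation inside
--   ResidualInductionKummer (stmt-Langlands-12173); informal until definitions normalizedBrauerHom +
--   satakeTransformModP land (texts of the retired route's stmt-Langlands-2814 apply verbatim). Setting: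
--   p prime, M ⊇ μ_p a number field, F = M(a^{1/p}) cyclic of degree p, v a finite place of M with v ∤
--   p·a·disc(F/M) (so q_v ≡ 1 mod p, KummerResidueCharOne), k = 𝔽̄_p; G_v = GL_{pn}(M_v) ⊃ K_v =
--   GL_{pn}(𝒪_v) adapted to 𝒪_F ⊗ 𝒪_v, σ = Ad(a^{1/p} ⊗ 1) (order p, K_v σ-stable and σ-plain), H_v =
--   G_v^σ = ∏_{w|v} GL_n(F_w), U_v =

-- item stmt-Langlands-12819 · support · rank 9 · open · by planner — informal only, no Lean statement yet:
--   [support] SmithTransferGL — the TV transfer instance inside ResidualInductionKummer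
--   (stmt-Langlands-12173); informal until definition modPHeckeEigensystemGL lands (text of the retired
--   route's stmt-Langlands-2815 applies verbatim). CLAIM (TV First Main Theorem, Kummer-inner instance):
--   p, M ⊇ μ_p, F = M(a^{1/p}) as in ResidualGaloisRepKummer; G = GL_{pn}/M, σ = Ad(a^{1/p}) (fixed
--   group H = Res_{F/M}GL_n, connected reductive), K ⊂ G(𝔸_M^∞) σ-stable and sufficiently small with U =
--   K^σ, V the set of σ-good places (all but finitely many, TV §5.1); if a k-character χ of ℋ(H_V, U_V;
--   k) occurs in H^*([

-- earlier AscentConjugationSolvableOfCyclicPrime (stmt-Langlands-19073, replaced 2026-08-17T08:22:24Z -> stmt-Langlands-17881): proved by Summit.Langlands.Langlands.Theorems.AscentConjugationSolvableSplit.ascentConjugationSolvableOfCyclicPrime_proof @ 9dabcc8927a4 — CyclicPrimeAscent → CyclicPrimeDescent → AscentConjugationSolvable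
/-- item stmt-Langlands-17881 · support · rank 9 · closed · proved by Summit.Langlands.Langlands.Theorems.AscentConjugationSolvableSplit.ascentConjugationSolvableOfCyclicPrime_proof (prover) · by planner
[support] GLUE of the crux-strategist split of AscentConjugationSolvable (stmt-Langlands-1094) into
CyclicPrimeAscent (stmt-Langlands-18649) and CyclicPrimeDescent (stmt-Langlands-18645), RESTATED 1:1
by route-repair rev 6 (2026-08-17) in the binder spelling `∀ (_ : CyclicPrimeAscent) (_ :
CyclicPrimeDescent), AscentConjugationSolvable` — the SAME proposition (identical term) as
stmt-Langlands-19073 `CyclicPrimeAscent → CyclicPrimeDescent → AscentConjugationSolvable`, restated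
only to DETACH the by-name closure of 19073
(`…Theorems.AscentConjugationSolvableSplit.ascentConjugationSolvableOfCyclicPrime_proof` in
Theorems/SmithKummerSeedAscentConjugationSolvableSplit.lean, a module that IMPORTS this Theses
file): the gate links `<Decl>_holds := _root_.<thm>` into the route file, which cannot name a
declaration of a module importing it (glue.cyclic-import; route unmaterialisable since 07:46Z — the
IrreducibleGL3CM incident of 2026-08-15, same remedy). The landed module stays green: it
re-elaborates verbatim against this decl (checked, rc 0). Content unchanged: reciprocity over TR ∪
CM ascends to every conjugation-solvable F once it ascends and descends along Galois layers of prime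
degr -/
@[route_item "route-Langlands-SmithKummerSeed"]
def AscentConjugationSolvableOfCyclicPrime : Prop :=
  ∀ (_ : CyclicPrimeAscent) (_ : CyclicPrimeDescent), AscentConjugationSolvable

-- `AscentConjugationSolvableOfCyclicPrime` holds: proved by `Summit.Langlands.Langlands.Theorems.AscentConjugationSolvableSplit.ascentConjugationSolvableOfCyclicPrime_proof` (its module imports this route file, so no `_holds` link can be stated here).

/-- item stmt-Langlands-18101 · support · rank 9 · open · by planner
[support] DATUM INDEPENDENCE of the summit's correspondence predicate — the exact price, for this
route, of the statement revision p141787 (2026-08-17: `Langlands := ∀ F, Nonempty (ReciprocityData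
F) ∧ ∀ Rec n, 0 < n → ∀ hcpt, GLC n F Rec hcpt`, reciprocity data PINNED to the canonical local
Artin maps by `llc_isCanonical` / `llc_eps_isCanonical`): for every number field F, any two
reciprocity data Rec, Rec′, every n ≥ 1, hcpt, cuspidal π of GL_n(𝔸_F), ℓ, ι : ℚ̄_ℓ ≃ ℂ and framed ρ
: Γ_F → GL_n(ℚ̄_ℓ), `Corresponds Rec ι π ρ → Corresponds Rec′ ι π ρ`. Verbatim (full names, binders
Rec/Rec′) the `DatumIndependence` of Cruxes/ReciprocityUpToIrreducibilityR/SketchIdeateR1K2.lean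
(idea henniart-rigidity-forall-rec, crux stmt-Langlands-17925's PICKED line), where it is DERIVED
sorry-free (`datumIndependence_of_genericRigidity ∘ genericRigidity_of_local`) from HENNIART
RIGIDITY ON GENERIC CLASSES (`LocalGenericRigidity`: two local Langlands data over F_v with
canonical Artin pins agree on every generic class — Henniart1993 Thm 1.1 = the tree's named fact
localLanglands_gl, uniqueness half, on supercuspidals, + localEpsilonSystem_unique
(DeligneAntwerpII1973 Thm 4.1) + Henniart2002 Thm 1.7/ -/
@[route_item "route-Langlands-SmithKummerSeed", crux]
def DatumIndependence : Prop :=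
  ∀ (F : Type) [Field F] [NumberField F] (Rec Rec' : ReciprocityData F) (n : ℕ), 0 < n → ∀ (hcpt : Literature.NumberTheory.Automorphic.isCompact_glFiniteIntegralLevel n F) (π : Literature.NumberTheory.Automorphic.CuspidalAutomorphicRepData n F hcpt) (ℓ : ℕ) [Fact ℓ.Prime] (ι : PadicAlgCl ℓ ≃+* ℂ) (ρ : Literature.NumberTheory.GaloisRepresentations.FramedGaloisRep F (PadicAlgCl ℓ) n), Corresponds Rec ι π.1 ρ → Corresponds Rec' ι π.1 ρ

-- earlier Assembly (stmt-Langlands-12176, replaced 2026-08-17T08:28:55Z -> stmt-Langlands-17904): retired by None — ResidualGaloisRepKummer → KummerPrimeLifting → KummerPrimeToAllPrimes → ReciprocityCMtoTR → AscentConjugationSolvable → AscentResidual → _root_.Langlands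
/-- item stmt-Langlands-17904 · assembly · rank 1 · closed · proved by Summit.Langlands.Langlands.Theorems.smithKummerSeed_assembly_proof (prover) · by planner
sources: BuzzardGeeLMS2014, TreumannVenkatesh2016
[assembly] ResidualGaloisRepKummer → KummerPrimeLifting → KummerPrimeToAllPrimes → ReciprocityCMtoTR
→ AscentConjugationSolvable → AscentResidual → DatumIndependence → Langlands — the deciding theorem
`closes` UNCURRIED, restated by route-repair rev 7 (2026-08-17) in lockstep with the statement
revision p141787 (`Langlands := ∀ F, Nonempty (ReciprocityData F) ∧ ∀ Rec n, …`): the chain gives,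
over every number field, a reciprocity datum R₀ WITH the correspondence (pre-revision currency `∃
R`); R₀ is the non-vacuity witness and DatumIndependence (stmt-Langlands-18101) transports (A)/(B)
from R₀ to every pinned datum (`IsGeometricFramed` is datum-free: `ReciprocityData.pst` pinned).
BOOKKEEPING ONLY — it is proved IN THE ROUTE FILE by `closes` (`fun h₂ h₃ h₄ hT h₅ h₆ hD => closes
h₂ h₃ h₄ hT h₅ h₆ hD`, axioms propext/Classical.choice/Quot.sound); provers attack the cruxes, not
this. PROVERS / GROUNDERS: do NOT close this item with a theorem whose module imports
Summits.Langlands.Langlands.Theses.SmithKummerSeed — the gate links `Assembly_holds := _root_.<thm>`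
into the route file and a module importing that file cycles (route unmaterialisable: the
AscentConjugationSolvableOfCyclicPrim -/
@[route_item "route-Langlands-SmithKummerSeed"]
def Assembly : Prop :=
  ResidualGaloisRepKummer → KummerPrimeLifting → KummerPrimeToAllPrimes → ReciprocityCMtoTR → AscentConjugationSolvable → AscentResidual → DatumIndependence → _root_.Langlands

-- `Assembly` holds: proved by `Summit.Langlands.Langlands.Theorems.smithKummerSeed_assembly_proof` (its module imports this route file, so no `_holds` link can be stated here).

/-! D-0027 §2.1 — DECIDING THEOREM (planner-authored via `route open/edit --closes-file`; by planner-rglue-Langlands-SmithKummerSeed-f1ba07c2-0 2026-08-17T08:22:24Z):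
its hypotheses are this route's items and its conclusion the sub-problem Statement (glue_lint), and it elaborates with this file. -/

@[closes "route-Langlands-SmithKummerSeed"] theorem closes (h₂ : ResidualGaloisRepKummer) (h₃ : KummerPrimeLifting) (h₄ : KummerPrimeToAllPrimes)
    (hT : ReciprocityCMtoTR) (h₅ : AscentConjugationSolvable) (h₆ : AscentResidual)
    (hD : DatumIndependence) : _root_.Langlands := by
  -- (1) the route's chain, unchanged: reciprocity data WITH the correspondence EXIST over every number field
  have hK := h₄ (h₃ h₂)
  have hCM : ∀ (F : Type) [Field F] [NumberField F], NumberField.IsCMField F →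
      ∃ R : ReciprocityData F, ∀ n : ℕ, 0 < n →
        ∀ hcpt : Literature.NumberTheory.Automorphic.isCompact_glFiniteIntegralLevel n F,
          GlobalLanglandsCorrespondenceGLn n F R hcpt := by
    intro F _ _ hF
    haveI : Fact (Nat.Prime 2) := ⟨Nat.prime_two⟩
    exact hK 2 (NumberField.maximalRealSubfield F) F (Or.inl inferInstance)
      ⟨-1, IsPrimitiveRoot.neg_one 0 (by decide)⟩
      (Algebra.IsQuadraticExtension.finrank_eq_two (NumberField.maximalRealSubfield F) F)
  have hTR := hT hCM
  have hAll := h₆ (h₅ fun F _ _ h => h.elim (fun hF => hTR F hF) (fun hF => hCM F hF))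
  -- (2) statement revision p141787 (`∀ F, Nonempty (ReciprocityData F) ∧ ∀ R n, …`): the witness gives the
  -- non-vacuity conjunct, and DatumIndependence transports the correspondence from the witness to EVERY datum
  -- (`IsGeometricFramed` is datum-free by definition of `ReciprocityData.pst`).
  intro F _ _
  obtain ⟨R₀, hR₀⟩ := hAll F
  refine ⟨⟨R₀⟩, fun Rec n hn hcpt => ?_⟩
  obtain ⟨hA, hB⟩ := hR₀ n hn hcpt
  refine ⟨fun π hπ ℓ _ ι => ?_, fun ℓ _ ι ρ hirr hgeo => ?_⟩
  · obtain ⟨ρ, hirr, hgeo, hcorr, huniq⟩ := hA π hπ ℓ ι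
    exact ⟨ρ, hirr, hgeo, hD F R₀ Rec n hn hcpt π ℓ ι ρ hcorr,
      fun ρ' h' => huniq ρ' (hD F Rec R₀ n hn hcpt π ℓ ι ρ' h')⟩
  · obtain ⟨π, hπ, hcorr⟩ := hB ℓ ι ρ hirr hgeo
    exact ⟨π, hπ, hD F R₀ Rec n hn hcpt π ℓ ι ρ hcorr⟩

end Summit.Langlands.Langlands.Theses.SmithKummerSeed
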